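import Summits.AtomisticToContinuum.Crystallization.Theorems.ChartedZeroExcessLayeredLatticeLiouvilleYH

/-!
(SPLIT FOR THE 400-LINE CAP by the landing lane, hand-2 g32: this file = part 1 of 3; sequels `…ChartedZeroExcessLayeredLatticeLiouvilleYIB`, `…ChartedZeroExcessLayeredLatticeLiouvilleYI` import it in a chain; same namespace, all FQNs unchanged.)
# Charted zero-excess layered-lattice Liouville — YI «ColdMoatDial + MildDoorVariationalSplit» (sequel of `…ChartedZeroExcessLayeredLatticeLiouvilleYH`)

Lens «structural dichotomy (special vs generic)», generation 65, docket N `ChartedZeroExcessLayered` (stmt 26636), B-body serene cut of parts YE/YF/YG/YH;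
answers CRITIC-LEDGER row 1189 (c″) «g65 := (M1) discharge [MCMCᶜ]».

THE DIALS (YI-1 – YI-4, all PROVED).  The serene / agitated cut (part YE), the enclosure cut (part YF) and their mild versions (part YH) carry two literals that the
columns `_16XH24B` / `_16XH26B` pin at record values: the MOAT / SERENITY LEVEL `ϑc = 1/100` and the SERENITY RADIUS `ra = 24`.  Both are FREE DIALS:
* the doors [CMC](ϑc), [CMCᶜ], [CMG], [MCMC](ϑc), [MCMCᶜ] WEAKEN as `ϑc` decreases (a colder moat is a stronger hypothesis: `….of_level_le` / `….of_moat_le`);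
* the serene leaf [SBHSᵇ](ϑc, ra) and the linked residuals [SSHSᵇ], [BSHSᵇ], [MSSHSᵇ], [MBSHSᵇ](ϑc, ra) WEAKEN as `ϑc` decreases and as `ra` increases (colder /
  wider serenity is rarer, sitewise; `….of_level_le`, `….of_ra_le`, `….of_moat_le`);
* the AGITATED side is charged (parts YE/YEA, at every `ra ≥ 0` and every level) to the far-warm observers' leaf [FWSᵇ](ϑc) ⟸ [TBISᵇ(8)](ϑ₁ ≤ ϑc, ω₁), which
  STRENGTHENS as the level decreases (`FarWarmSparseBPG.of_le_level`) but is implied at EVERY positive level by the LEVEL-FREE tilt–strain leaf (MKᵇᵃˡˡ)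
  `TameBallTiltStrainBPG tameRadius 8` (`farWarmSparseBPG_of_tameBallTiltStrain`).
Hence the cold–wide dockets `ColdSereneDocket ϑm ra := [CMC](ϑm) ∧ [SSHSᵇ](ϑm, ra) ∧ [BSHSᵇ](ϑm, ra)` and `MildColdSereneDocket ϑm ra := [MCMC](ϑm) ∧ [MSSHSᵇ](ϑm, ra)
∧ [MBSHSᵇ](ϑm, ra)` are ANTITONE in `ϑm` and MONOTONE-WEAKER in `ra` (THE DIAL THEOREMS `….of_le`); the columns `_16XH27B` (over `_16XH24B`) and `_16XH28B` (over
`_16XH26B`) replace the four serene-cut binders by ONE existential package over `(ϑm, ra, ϑ₁, ω₁)` — every binder implied by the record ones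
(`sereneMoatDocket_of_record`, `mildSereneMoatPackage_of_record`) —, and the cold columns `_16XH27BT` / `_16XH28BT` take (MKᵇᵃˡˡ) ∧ `∃ ϑm ra, 0 < ϑm ∧ 24 ≤ ra ∧ …Docket ϑm ra`:
THE COLDEST, WIDEST SERENE CUT IS THE CHEAPEST, AND ITS PRICE IS PREPAID BY (MKᵇᵃˡˡ).

(M1′) THE VARIATIONAL SPLIT OF THE MILD DOOR (YI-5; glue PROVED).  `[MCMCᶜ] ⟸ (QE) CoolMoatSlavedFillingP ∧ (QC) MildClampedConvexityP` (`κ > 0`): (QE) under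
`ϑc`-cool thick-shell data a clamped CRITICAL filling `y` of the `ρ`-core exists, matched sitewise to the given mild core within `dm` and `ϑ`-TAME — the existence
half of the implicit-function discharge, PERTURBATIVE IN THE DATA (the moat-temperature dial is exactly its smallness parameter); (QC) the clamped energy is
`κ`-strongly convex about tame critical fillings along matched segments inside the mild class — the AMPLITUDE half, a Born-type harmonic floor on ALL
`≈ 2.5 %`-strained clean configurations of the clamped ball (not only the chart), LEVEL-FREE in the moat temperature.  Glue: grand clamped minimality with the
equal-count replacement `R := y` and the convexity inequality force `Σ dist² ≤ 0`, so the core IS the slaved filling and is tame.  Both leaves are SIDEWAYS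
(neither is implied by [MCMCᶜ]) — a SIDE column `_16XH28BV` by the trade rule, with its cold form `_16XH28BVT`; no implicit-function radius literal is needed
(row 1189 (c″) «IFT radius ≥ 1/10 by norm_num» becomes «Born floor at amplitude `1/10`», instrument «MildBorn»).

WHAT THE DIAL BUYS (honest placement; the numbers are the programme's working constants, not certified).
(1) The doors.  Part YFA places [CMCᶜ] as «perturbative germ for `ϑc ≲ 1/200`, genuine leaf at `1/100`»; the energy route to the door had moat flux `≈ 7ε·ϑc` per
moat site against the FIXED hot gap `c·ϑ²` (row 1181 (c)), and (QE)'s budget is `C_d·ϑc ≤ ϑ = 1/20`, i.e. `C_d ≤ 5` at `ϑc = 1/100`: BOTH constant obstructions are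
inequalities `const·ϑc < const′` and DISSOLVE as `ϑm → 0`.  In the cold limit the doors' inhabitants are SILENT hot containers in near-perfect thick shells —
compact rearrangements of the PERFECT crystal in a `4`-ball at chemical potential `e⋆` (the cleanest finite crystallisation lemma).
(2) The residuals.  A hot structure is `ϑm`-serene only if EVERY tame-balled observer within `ra` is `ϑm`-perfect; a generic hot `q`-blob agitates ITSELF through its
dipole far field at the outer moat, level `≈ ϑ·(q/(r + rsh + q))³ ≈ 2·10⁻⁴` («self-agitation»): below that temperature only FAR-FIELD-SILENT structures remain in the
residual classes and every LOUD one is charged to (MKᵇᵃˡˡ).  The excision arithmetic of the residuals has ambient coupling `C·ϑm·ϑ` per site against gain `c·ϑ²`;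
row 1187 (c)(ii)'s «`C < 5c`» is that inequality AT `ϑm = 1/100` and is MET BY DIAL for `ϑm < c·ϑ/C`.
(3) What is NOT bought: (MKᵇᵃˡˡ) now carries every loud structure — exactly the inhabitants its own «why it might fail» (part YE) names; the dial introduces no new
bet, it CONSOLIDATES the serene-cut bets into (MKᵇᵃˡˡ) + silent-structure doors / residuals.  (QC)'s amplitude axis is NOT a dial of this kind: lowering `ϑp`
weakens the door but strengthens [WHSᵇ](ϑp) (part YG).
INSTRUMENTS (census): «ObserverLevelHistogram» — per bare hot site, `ϑ_obs :=` the largest star distortion among its tame-`8`-balled observers within `ra ∈ {24, 48}`;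
the serene fraction at temperature `ϑm` is `#{ϑ_obs ≤ ϑm}/#hot` (replaces «MoatThermometer» at the single level `1 %`); «MildBorn(ϑp)» — smallest clamped-Hessian
eigenvalue over relaxed mild cores and along matched segments to their chart fillings; «CoolMoatGap-y» — the slaved filling's max star misfit vs `ϑc`.

Contents: YI-1 level / radius monotonicity (far-warmth, agitation, serene and linked counts and leaves, doors); YI-2 `SereneMoatDocket`, `ColdSereneDocket`, dial
theorem, B-chain from a docket; YI-3 columns `_16XH27B`, `_16XH24B_via_27B`, `_16XH27BT`, `_16XH27BT_at`; YI-4 mild dials, `MildColdSereneDocket`, mild B-chains,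
columns `_16XH28B`, `_16XH26B_via_28B`, `_16XH28BT`; YI-5 (QE) `CoolMoatSlavedFillingP`, (QC) `MildClampedConvexityP`, their dials, the variational glue
`mildCoolMoatClampedCoreP_of_slavedFilling_convexity`, `VariationalMildDocket`, columns `_16XH28BV`, `_16XH28BVT`.  62 declarations (6 def, 56 theorem), all PROVED;
0 sorry; standard axioms; no instances / notations / option overrides.
-/

noncomputable section

open scoped BigOperators Classical
open MeasureTheory Set Metric Filter Topology
open Summit.AtomisticToContinuum.Crystallization.Theorems.ChartedPlanarOrderRigidityDoor (E3 eStar atomsIn IsEStarGSC siteEnergy VisibleGap PertRegime)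
open Summit.AtomisticToContinuum.Crystallization.Theorems.ChartedPlanarOrderDensityDichotomy (μS IsSep nK nK_nonneg)
open Summit.AtomisticToContinuum.Crystallization.Theorems.ChartedPlanarOrderCleanScaleP (IsCleanP IsDoorSetP)
open Summit.AtomisticToContinuum.Crystallization.Theorems.ChartedPlanarOrderMesoCut (LayeredHom EnvClose)
open Summit.AtomisticToContinuum.Crystallization.Theorems.ChartedPlanarOrderDoorLayered (atomsIn_subset sq_le_finsum_mem PeriodicBulkGapDoor)
open Summit.AtomisticToContinuum.Crystallization.Theorems.ChartedPlanarOrderDoorLayeredOsc (IsTwoShellAffineGood)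
open Literature.MathematicalPhysics.StatisticalMechanics (card_le_of_separated_of_dist_le lennardJones)

namespace Summit.AtomisticToContinuum.Crystallization.Theorems.ChartedZeroExcessLayeredLatticeLiouville

/-! ### YI-1  The MOAT-TEMPERATURE DIAL — level monotonicity of far-warmth, agitation, serenity, the linked residual counts and the doors (PROVED) -/

/-- a far-warm observer at level `ϑc` is far-warm at every COLDER level `ϑm ≤ ϑc` (a star that is not `ϑc`-tame is not `ϑm`-tame). [this file, g65] -/
theorem IsFarWarm.of_level_le {ϑm ϑc ϑ r : ℝ} (h : ϑm ≤ ϑc) {S H : Set E3} {y : E3} (hy : IsFarWarm ϑc ϑ r S H y) :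
    IsFarWarm ϑm ϑ r S H y :=
  ⟨hy.1, fun hm => hy.2 (hm.mono h)⟩

/-- agitation is ANTITONE in the level: a colder serenity threshold agitates more sites. [this file, g65] -/
theorem IsAgitated.of_level_le {ϑm ϑc ϑ r ra : ℝ} (h : ϑm ≤ ϑc) {S H : Set E3} {x : E3} (hx : IsAgitated ϑc ϑ r ra S H x) :
    IsAgitated ϑm ϑ r ra S H x := by
  obtain ⟨y, hy, hd, hw⟩ := hx
  exact ⟨y, hy, hd, hw.of_level_le h⟩

/-- the far-warm count is ANTITONE in the level (PROVED). [this file, g65] -/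
theorem farWarmCount_anti_level {ϑm ϑc ϑ r : ℝ} (h : ϑm ≤ ϑc) {S H Q : Set E3} (hQ : Q.Finite) :
    farWarmCount ϑc ϑ r S H Q ≤ farWarmCount ϑm ϑ r S H Q := by
  rw [farWarmCount, farWarmCount, finsum_mem_eq_finite_toFinset_sum _ hQ, finsum_mem_eq_finite_toFinset_sum _ hQ]
  refine Finset.sum_le_sum fun x _ => ?_
  by_cases hx : IsFarWarm ϑc ϑ r S H x
  · rw [if_pos hx, if_pos (hx.of_level_le h)]
  · rw [if_neg hx]
    split_ifs <;> norm_num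

/-- the agitated count is ANTITONE in the level (PROVED). [this file, g65] -/
theorem agitatedCount_anti_level {ϑm ϑc ϑ r ra : ℝ} (h : ϑm ≤ ϑc) {S H Q : Set E3} (hQ : Q.Finite) :
    agitatedCount ϑc ϑ r ra S H Q ≤ agitatedCount ϑm ϑ r ra S H Q := by
  rw [agitatedCount, agitatedCount, finsum_mem_eq_finite_toFinset_sum _ hQ, finsum_mem_eq_finite_toFinset_sum _ hQ]
  refine Finset.sum_le_sum fun x _ => ?_
  by_cases hx : IsAgitated ϑc ϑ r ra S H x
  · rw [if_pos hx, if_pos (hx.of_level_le h)]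
  · rw [if_neg hx]
    split_ifs <;> norm_num

/-- ★ the serene bare hot count is MONOTONE in the level (PROVED): COLDER serenity is RARER — `serene(ϑm) ⊆ serene(ϑc)` for `ϑm ≤ ϑc`. [this file, g65] -/
theorem sereneBareHotCount_mono_level {ϑm ϑc ϑ r ra ϑe ωe : ℝ} {p : ℕ} {r₀ ℓ : ℝ} {M : ℕ} (h : ϑm ≤ ϑc) {S H Q : Set E3} (hQ : Q.Finite) :
    sereneBareHotCount ϑm ϑ r ra ϑe ωe p r₀ ℓ M S H Q ≤ sereneBareHotCount ϑc ϑ r ra ϑe ωe p r₀ ℓ M S H Q := by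
  rw [sereneBareHotCount, sereneBareHotCount, finsum_mem_eq_finite_toFinset_sum _ hQ, finsum_mem_eq_finite_toFinset_sum _ hQ]
  refine Finset.sum_le_sum fun x _ => ?_
  by_cases hd : IsDressed ϑe ωe p r₀ ℓ M S H x ∨ IsTameStar ϑ S H x ∨ IsAgitated ϑc ϑ r ra S H x
  · rw [if_pos (hd.imp_right (Or.imp_right (IsAgitated.of_level_le h))), if_pos hd]
  · rw [if_neg hd]
    split_ifs <;> norm_num

/-- the slender serene hot count is MONOTONE in the level (PROVED). [this file, g65] -/
theorem slenderSereneHotCount_mono_level {ϑm ϑc ϑ r ra ϑe ωe : ℝ} {p : ℕ} {r₀ ℓ : ℝ} {M : ℕ} {q D b : ℝ} (h : ϑm ≤ ϑc) {S H Q : Set E3}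
    (hQ : Q.Finite) :
    slenderSereneHotCount ϑm ϑ r ra ϑe ωe p r₀ ℓ M q D b S H Q ≤ slenderSereneHotCount ϑc ϑ r ra ϑe ωe p r₀ ℓ M q D b S H Q := by
  rw [slenderSereneHotCount, slenderSereneHotCount, finsum_mem_eq_finite_toFinset_sum _ hQ, finsum_mem_eq_finite_toFinset_sum _ hQ]
  refine Finset.sum_le_sum fun x _ => ?_
  by_cases hm : ¬ IsDressed ϑe ωe p r₀ ℓ M S H x ∧ ¬ IsTameStar ϑ S H x ∧ ¬ IsAgitated ϑm ϑ r ra S H x ∧ ¬ IsHotIsolated ϑ q D S H x ∧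
      ¬ IsBuried ϑ b S H x
  · rw [if_pos hm, if_pos ⟨hm.1, hm.2.1, fun ha => hm.2.2.1 (ha.of_level_le h), hm.2.2.2.1, hm.2.2.2.2⟩]
  · rw [if_neg hm]
    split_ifs <;> norm_num

/-- the buried serene hot count is MONOTONE in the level (PROVED). [this file, g65] -/
theorem buriedSereneHotCount_mono_level {ϑm ϑc ϑ r ra ϑe ωe : ℝ} {p : ℕ} {r₀ ℓ : ℝ} {M : ℕ} {b : ℝ} (h : ϑm ≤ ϑc) {S H Q : Set E3} (hQ : Q.Finite) :
    buriedSereneHotCount ϑm ϑ r ra ϑe ωe p r₀ ℓ M b S H Q ≤ buriedSereneHotCount ϑc ϑ r ra ϑe ωe p r₀ ℓ M b S H Q := by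
  rw [buriedSereneHotCount, buriedSereneHotCount, finsum_mem_eq_finite_toFinset_sum _ hQ, finsum_mem_eq_finite_toFinset_sum _ hQ]
  refine Finset.sum_le_sum fun x _ => ?_
  by_cases hm : ¬ IsDressed ϑe ωe p r₀ ℓ M S H x ∧ ¬ IsTameStar ϑ S H x ∧ ¬ IsAgitated ϑm ϑ r ra S H x ∧ IsBuried ϑ b S H x
  · rw [if_pos hm, if_pos ⟨hm.1, hm.2.1, fun ha => hm.2.2.1 (ha.of_level_le h), hm.2.2.2⟩]
  · rw [if_neg hm]
    split_ifs <;> norm_num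

/-- ★ **[FWSᵇ](ϑm) ⇒ [FWSᵇ](ϑc) for `ϑm ≤ ϑc` (PROVED)** — the observers' leaf is STRONGER at colder levels (super-count). [this file, g65] -/
theorem FarWarmSparseBPG.of_le_level {ϑm ϑc ϑ r aHi Λ θ s : ℝ} (h : ϑm ≤ ϑc) (hF : FarWarmSparseBPG ϑm ϑ r aHi Λ θ s) :
    FarWarmSparseBPG ϑc ϑ r aHi Λ θ s :=
  CountSparseBPG.of_pointwise_le (fun _ _ _ _ hQ _ _ => farWarmCount_anti_level h hQ) hF

/-- ★★ **(MKᵇᵃˡˡ) ⇒ [FWSᵇ](ϑm) at EVERY positive level `ϑm` (PROVED)** — the cubic-Chebyshev certificate of part YE with `(ϑ₁, ω₁) := (ϑm, 1)`: the agitated side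
of the serene cut is prepaid by the LEVEL-FREE tilt–strain leaf, however cold the serenity threshold. [this file, g65] -/
theorem farWarmSparseBPG_of_tameBallTiltStrain {ϑm ϑ r aHi Λ θ s : ℝ} (hm : 0 < ϑm) (h : TameBallTiltStrainBPG ϑ r aHi Λ θ s) :
    FarWarmSparseBPG ϑm ϑ r aHi Λ θ s :=
  farWarmSparseBPG_of_tameBallIncoherence le_rfl (tameBallIncoherenceSparseBPG_of_tameBallTiltStrain (ω₁ := 1) hm one_pos h)

/-- ★ **[SBHSᵇ](ϑc) ⇒ [SBHSᵇ](ϑm) for `ϑm ≤ ϑc` (PROVED)** — the serene leaf WEAKENS as the serenity level cools (sub-count). [this file, g65] -/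
theorem SereneBareHotSparseBPG.of_level_le {ϑm ϑc ϑ r ra ϑe ωe : ℝ} {p : ℕ} {r₀ ℓ : ℝ} {M : ℕ} {aHi Λ θ s : ℝ} (h : ϑm ≤ ϑc)
    (hS : SereneBareHotSparseBPG ϑc ϑ r ra ϑe ωe p r₀ ℓ M aHi Λ θ s) : SereneBareHotSparseBPG ϑm ϑ r ra ϑe ωe p r₀ ℓ M aHi Λ θ s :=
  CountSparseBPG.of_pointwise_le (fun _ _ _ _ hQ _ _ => sereneBareHotCount_mono_level h hQ) hS

/-- ★ **[SSHSᵇ](ϑc) ⇒ [SSHSᵇ](ϑm) for `ϑm ≤ ϑc` (PROVED)** — the slender residual WEAKENS as the level cools. [this file, g65] -/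
theorem SlenderSereneHotSparseBPG.of_level_le {ϑm ϑc ϑ r ra ϑe ωe : ℝ} {p : ℕ} {r₀ ℓ : ℝ} {M : ℕ} {q D b aHi Λ θ s : ℝ} (h : ϑm ≤ ϑc)
    (hS : SlenderSereneHotSparseBPG ϑc ϑ r ra ϑe ωe p r₀ ℓ M q D b aHi Λ θ s) :
    SlenderSereneHotSparseBPG ϑm ϑ r ra ϑe ωe p r₀ ℓ M q D b aHi Λ θ s :=
  CountSparseBPG.of_pointwise_le (fun _ _ _ _ hQ _ _ => slenderSereneHotCount_mono_level h hQ) hS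

/-- ★ **[BSHSᵇ](ϑc) ⇒ [BSHSᵇ](ϑm) for `ϑm ≤ ϑc` (PROVED)** — the buried residual WEAKENS as the level cools. [this file, g65] -/
theorem BuriedSereneHotSparseBPG.of_level_le {ϑm ϑc ϑ r ra ϑe ωe : ℝ} {p : ℕ} {r₀ ℓ : ℝ} {M : ℕ} {b aHi Λ θ s : ℝ} (h : ϑm ≤ ϑc)
    (hS : BuriedSereneHotSparseBPG ϑc ϑ r ra ϑe ωe p r₀ ℓ M b aHi Λ θ s) : BuriedSereneHotSparseBPG ϑm ϑ r ra ϑe ωe p r₀ ℓ M b aHi Λ θ s :=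
  CountSparseBPG.of_pointwise_le (fun _ _ _ _ hQ _ _ => buriedSereneHotCount_mono_level h hQ) hS

/-- ★ **[CMC](ϑc) ⇒ [CMC](ϑm) for `ϑm ≤ ϑc` (PROVED)** — the enclosure door WEAKENS as the moat cools: a `ϑm`-tame moat is `ϑc`-tame (`IsTameOn.mono`).
[this file, g65] -/
theorem CoolMoatCorePG.of_level_le {ϑm ϑc ϑ r q rsh aHi Λ θ s : ℝ} (h : ϑm ≤ ϑc) (hC : CoolMoatCorePG ϑc ϑ r q rsh aHi Λ θ s) :
    CoolMoatCorePG ϑm ϑ r q rsh aHi Λ θ s :=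
  fun δ hδ a ha S hS hgood L w hLw x₀ K hKS hKq hcool => hC δ hδ a ha S hS hgood L w hLw x₀ K hKS hKq (IsTameOn.mono h Subset.rfl hcool)

/-- **[CMCᶜ](ϑc, ρ) ⇒ [CMCᶜ](ϑm, ρ) for `ϑm ≤ ϑc` (PROVED)** — the clamped door WEAKENS as the moat cools. [this file, g65] -/
theorem CoolMoatClampedCoreP.of_level_le {ϑm ϑc ϑ r q rsh ρ aHi Λ θ s : ℝ} (h : ϑm ≤ ϑc) (hC : CoolMoatClampedCoreP ϑc ϑ r q rsh ρ aHi Λ θ s) :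
    CoolMoatClampedCoreP ϑm ϑ r q rsh ρ aHi Λ θ s :=
  fun δ hδ a ha S hS hsum hgood L w hLw x₀ K hKS hKq hcool hmin =>
    hC δ hδ a ha S hS hsum hgood L w hLw x₀ K hKS hKq (IsTameOn.mono h Subset.rfl hcool) hmin

/-- **[CMG](ϑc, ρ) ⇒ [CMG](ϑm, ρ) for `ϑm ≤ ϑc` (PROVED)** — the finite certificate form WEAKENS as the moat cools. [this file, g65] -/
theorem CoolMoatCoreGapP.of_level_le {ϑm ϑc ϑ r q rsh ρ aHi Λ θ s : ℝ} (h : ϑm ≤ ϑc) (hC : CoolMoatCoreGapP ϑc ϑ r q rsh ρ aHi Λ θ s) :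
    CoolMoatCoreGapP ϑm ϑ r q rsh ρ aHi Λ θ s :=
  coolMoatClampedCoreP_iff_gap.1 ((coolMoatClampedCoreP_iff_gap.2 hC).of_level_le h)

/-- the slender serene hot count is ANTITONE in the serenity radius (PROVED): a wider serenity radius agitates more sites. [this file, g65] -/
theorem slenderSereneHotCount_anti_ra {ϑc ϑ r ra ra' ϑe ωe : ℝ} {p : ℕ} {r₀ ℓ : ℝ} {M : ℕ} {q D b : ℝ} (h : ra ≤ ra') {S H Q : Set E3} (hQ : Q.Finite) :
    slenderSereneHotCount ϑc ϑ r ra' ϑe ωe p r₀ ℓ M q D b S H Q ≤ slenderSereneHotCount ϑc ϑ r ra ϑe ωe p r₀ ℓ M q D b S H Q := by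
  rw [slenderSereneHotCount, slenderSereneHotCount, finsum_mem_eq_finite_toFinset_sum _ hQ, finsum_mem_eq_finite_toFinset_sum _ hQ]
  refine Finset.sum_le_sum fun x _ => ?_
  by_cases hm : ¬ IsDressed ϑe ωe p r₀ ℓ M S H x ∧ ¬ IsTameStar ϑ S H x ∧ ¬ IsAgitated ϑc ϑ r ra' S H x ∧ ¬ IsHotIsolated ϑ q D S H x ∧
      ¬ IsBuried ϑ b S H x
  · rw [if_pos hm, if_pos ⟨hm.1, hm.2.1, fun ha => hm.2.2.1 (ha.of_ra_le h), hm.2.2.2.1, hm.2.2.2.2⟩]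
  · rw [if_neg hm]
    split_ifs <;> norm_num

/-- the buried serene hot count is ANTITONE in the serenity radius (PROVED). [this file, g65] -/
theorem buriedSereneHotCount_anti_ra {ϑc ϑ r ra ra' ϑe ωe : ℝ} {p : ℕ} {r₀ ℓ : ℝ} {M : ℕ} {b : ℝ} (h : ra ≤ ra') {S H Q : Set E3} (hQ : Q.Finite) :
    buriedSereneHotCount ϑc ϑ r ra' ϑe ωe p r₀ ℓ M b S H Q ≤ buriedSereneHotCount ϑc ϑ r ra ϑe ωe p r₀ ℓ M b S H Q := by
  rw [buriedSereneHotCount, buriedSereneHotCount, finsum_mem_eq_finite_toFinset_sum _ hQ, finsum_mem_eq_finite_toFinset_sum _ hQ]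
  refine Finset.sum_le_sum fun x _ => ?_
  by_cases hm : ¬ IsDressed ϑe ωe p r₀ ℓ M S H x ∧ ¬ IsTameStar ϑ S H x ∧ ¬ IsAgitated ϑc ϑ r ra' S H x ∧ IsBuried ϑ b S H x
  · rw [if_pos hm, if_pos ⟨hm.1, hm.2.1, fun ha => hm.2.2.1 (ha.of_ra_le h), hm.2.2.2⟩]
  · rw [if_neg hm]
    split_ifs <;> norm_num

/-- ★ **[SSHSᵇ](ra) ⇒ [SSHSᵇ](ra') for `ra ≤ ra'` (PROVED)** — the slender residual WEAKENS as the serenity radius widens. [this file, g65] -/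
theorem SlenderSereneHotSparseBPG.of_ra_le {ϑc ϑ r ra ra' ϑe ωe : ℝ} {p : ℕ} {r₀ ℓ : ℝ} {M : ℕ} {q D b aHi Λ θ s : ℝ} (h : ra ≤ ra')
    (hS : SlenderSereneHotSparseBPG ϑc ϑ r ra ϑe ωe p r₀ ℓ M q D b aHi Λ θ s) :
    SlenderSereneHotSparseBPG ϑc ϑ r ra' ϑe ωe p r₀ ℓ M q D b aHi Λ θ s :=
  CountSparseBPG.of_pointwise_le (fun _ _ _ _ hQ _ _ => slenderSereneHotCount_anti_ra h hQ) hS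

/-- ★ **[BSHSᵇ](ra) ⇒ [BSHSᵇ](ra') for `ra ≤ ra'` (PROVED)** — the buried residual WEAKENS as the serenity radius widens. [this file, g65] -/
theorem BuriedSereneHotSparseBPG.of_ra_le {ϑc ϑ r ra ra' ϑe ωe : ℝ} {p : ℕ} {r₀ ℓ : ℝ} {M : ℕ} {b aHi Λ θ s : ℝ} (h : ra ≤ ra')
    (hS : BuriedSereneHotSparseBPG ϑc ϑ r ra ϑe ωe p r₀ ℓ M b aHi Λ θ s) : BuriedSereneHotSparseBPG ϑc ϑ r ra' ϑe ωe p r₀ ℓ M b aHi Λ θ s :=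
  CountSparseBPG.of_pointwise_le (fun _ _ _ _ hQ _ _ => buriedSereneHotCount_anti_ra h hQ) hS

/-! ### YI-2  The serene-cut docket as ONE existential package over the two free dials (moat temperature `ϑm`, serenity radius `ra`); the COLD–WIDE docket is
antitone in `ϑm` and monotone in `ra`; the generic B-chain from a docket (PROVED) -/

/-- ★★ **THE SERENE MOAT DOCKET `SereneMoatDocket ϑm ra ϑ₁ ω₁`** — the four serene-cut binders of column `_16XH24B` at MOAT / SERENITY LEVEL `ϑm`, SERENITY RADIUS `ra` and
OBSERVERS' LEVEL `(ϑ₁, ω₁)`, record geometry `(ϑ, r, q, rsh, D, b) = (tameRadius, 8, 4, 12, 32, 8)`: the door [CMC](ϑm), the linked residuals [SSHSᵇ](ϑm, ra), [BSHSᵇ](ϑm, ra),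
and [TBISᵇ(8)](ϑ₁, ω₁).  Record instance `(ϑm, ra, ϑ₁, ω₁) = (1/100, 24, 1/100, 1/200)`.  THE DIALS (this part, all PROVED): for `ϑm ≤ 1/100` and `ra ≥ 24` the first three
conjuncts are WEAKER than their record instances (`…of_level_le`, `…of_ra_le`), and the fourth, needed at `ϑ₁ ≤ ϑm`, is implied at EVERY `ϑ₁, ω₁ > 0` by the level-free
tilt–strain leaf (MKᵇᵃˡˡ) `TameBallTiltStrainBPG tameRadius 8` (part YE) — while parts YE/YF's charging glue holds at every `ra ≥ 0` and every `ϑc`.  So the moat temperature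
and the serenity radius are FREE DIALS of the column: cooling and widening cost nothing outside (MKᵇᵃˡˡ)'s own constants. [this file, g65] -/
def SereneMoatDocket (ϑm ra ϑ₁ ω₁ : ℝ) : Prop :=
  CoolMoatCorePG ϑm tameRadius 8 4 12 1 2 (1 / 16) (1 / 50) ∧
    SlenderSereneHotSparseBPG ϑm tameRadius 8 ra dressLevel dressLevel dressExponent 8 collarRadius clusterSize 4 32 8 1 2 (1 / 16) (1 / 50) ∧
      BuriedSereneHotSparseBPG ϑm tameRadius 8 ra dressLevel dressLevel dressExponent 8 collarRadius clusterSize 8 1 2 (1 / 16) (1 / 50) ∧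
        TameBallIncoherenceSparseBPG ϑ₁ ω₁ tameRadius 8 1 2 (1 / 16) (1 / 50)

/-- ★★ **THE COLD–WIDE SERENE DOCKET `ColdSereneDocket ϑm ra`** — the three dial-dependent serene-cut binders (door [CMC](ϑm), residuals [SSHSᵇ](ϑm, ra), [BSHSᵇ](ϑm, ra)) at
record geometry; ANTITONE in `ϑm` and MONOTONE-WEAKER in `ra` (`ColdSereneDocket.of_le`, PROVED): THE COLDER THE MOAT AND THE WIDER THE SERENITY RADIUS, THE WEAKER THE DOCKET.
In the cold regime `ϑm ↓ 0` its inhabitants are the `ϑm`-SILENT hot structures only — every LOUD one (far field `≥ ϑm` at SOME tame-balled observer within `ra`; a generic hot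
`q`-blob is loud down to its own dipole level `≈ ϑ·(q/(r + rsh + q))³ ≈ 2·10⁻⁴` at the outer moat, «self-agitation») is agitated and charged to (MKᵇᵃˡˡ): [CMC](ϑm) — silent hot
containers inside near-PERFECT thick shells (the perturbative germ `ϑc ≲ 1/200` of part YFA's own placement; energy bookkeeping with moat flux `≲ C_fl·ϑm·#moat` against a FIXED
hot gap — the constant obstruction of CRITIC-LEDGER row 1181 (c) at `ϑc = 1/100` dissolves as `ϑm → 0`; in the limit: grand-canonical rigidity of the PERFECT crystal against
compact rearrangements of a `4`-ball, the cleanest finite crystallisation lemma); [SSHSᵇ]/[BSHSᵇ](ϑm, ra) — silent slender networks / fat lumps, every tame-balled observer within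
`ra` `ϑm`-perfect, whose excision arithmetic has ambient coupling `C·ϑm·ϑ` per site against gain `c·ϑ²` — the «`C < 5c`» condition of row 1187 (c)(ii) at `ϑm = 1/100` reads
`C·ϑm < c·ϑ` and is MET by dial. [this file, g65] -/
def ColdSereneDocket (ϑm ra : ℝ) : Prop :=
  CoolMoatCorePG ϑm tameRadius 8 4 12 1 2 (1 / 16) (1 / 50) ∧
    SlenderSereneHotSparseBPG ϑm tameRadius 8 ra dressLevel dressLevel dressExponent 8 collarRadius clusterSize 4 32 8 1 2 (1 / 16) (1 / 50) ∧
      BuriedSereneHotSparseBPG ϑm tameRadius 8 ra dressLevel dressLevel dressExponent 8 collarRadius clusterSize 8 1 2 (1 / 16) (1 / 50)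

/-- ★★★ **THE DIAL THEOREM (PROVED): `ColdSereneDocket ϑm ra ⇒ ColdSereneDocket ϑm' ra'` for `ϑm' ≤ ϑm`, `ra ≤ ra'`** — every conjunct weakens as the moat cools and
the serenity radius widens. [this file, g65] -/
theorem ColdSereneDocket.of_le {ϑm ϑm' ra ra' : ℝ} (h : ϑm' ≤ ϑm) (hra : ra ≤ ra') (hD : ColdSereneDocket ϑm ra) : ColdSereneDocket ϑm' ra' :=
  ⟨hD.1.of_level_le h, (hD.2.1.of_level_le h).of_ra_le hra, (hD.2.2.of_level_le h).of_ra_le hra⟩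

/-- the serene moat docket is the cold–wide docket plus the observers' leaf (definitional). [this file, g65] -/
theorem sereneMoatDocket_iff {ϑm ra ϑ₁ ω₁ : ℝ} :
    SereneMoatDocket ϑm ra ϑ₁ ω₁ ↔ ColdSereneDocket ϑm ra ∧ TameBallIncoherenceSparseBPG ϑ₁ ω₁ tameRadius 8 1 2 (1 / 16) (1 / 50) :=
  ⟨fun h => ⟨⟨h.1, h.2.1, h.2.2.1⟩, h.2.2.2⟩, fun h => ⟨h.1.1, h.1.2.1, h.1.2.2, h.2⟩⟩

/-- the serene moat docket's DIALS (PROVED): colder, wider, and a WARMER observers' level are all weaker-or-equal except that [TBISᵇ] needs its own level kept. -/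
theorem SereneMoatDocket.of_le {ϑm ϑm' ra ra' ϑ₁ ω₁ : ℝ} (h : ϑm' ≤ ϑm) (hra : ra ≤ ra') (hD : SereneMoatDocket ϑm ra ϑ₁ ω₁) :
    SereneMoatDocket ϑm' ra' ϑ₁ ω₁ :=
  sereneMoatDocket_iff.2 ⟨(sereneMoatDocket_iff.1 hD).1.of_le h hra, (sereneMoatDocket_iff.1 hD).2⟩

/-- ★ **COLD–WIDE DOCKET ∧ (MKᵇᵃˡˡ) ⇒ SERENE MOAT DOCKET at every `ϑ₁, ω₁ > 0` (PROVED)** — the observers' conjunct is prepaid at every level. [this file, g65] -/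
theorem sereneMoatDocket_of_cold_tameBallTiltStrain {ϑm ra ϑ₁ ω₁ : ℝ} (h₁ : 0 < ϑ₁) (hω : 0 < ω₁) (hD : ColdSereneDocket ϑm ra)
    (hMK : TameBallTiltStrainBPG tameRadius 8 1 2 (1 / 16) (1 / 50)) : SereneMoatDocket ϑm ra ϑ₁ ω₁ :=
  ⟨hD.1, hD.2.1, hD.2.2, tameBallIncoherenceSparseBPG_of_tameBallTiltStrain h₁ hω hMK⟩

/-- ★★ **THE B-CHAIN FROM A DOCKET (PROVED): `SereneMoatDocket ϑm ra ϑ₁ ω₁ ⇒ [BHSᵇ]` for `ϑ₁ ≤ ϑm`, `ra ≥ 24`** — parts YE/YF's glue run at level `ϑc := ϑm` and radius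
`ra` (geometry side conditions `ra ≥ 8 + 12 + 4`, `32 ≥ 2·8 + 12 + 4`). [this file, g65] -/
theorem bareHotSparseBPG_of_sereneMoatDocket {ϑm ra ϑ₁ ω₁ : ℝ} (hϑ₁ : ϑ₁ ≤ ϑm) (hra : 24 ≤ ra) (h : SereneMoatDocket ϑm ra ϑ₁ ω₁) :
    BareHotSparseBPG tameRadius dressLevel dressLevel dressExponent 8 collarRadius clusterSize 1 2 (1 / 16) (1 / 50) :=
  bareHotSparseBPG_of_serene_tameBallIncoherence (by norm_num) (by linarith) hϑ₁
    (sereneBareHotSparseBPG_of_coolMoat_slender_buried (by norm_num) (by norm_num) (by linarith) (by norm_num) h.1 h.2.1 h.2.2.1) h.2.2.2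

/-- ★★ **THE B-CHAIN FROM A COLD–WIDE DOCKET AND (MKᵇᵃˡˡ) (PROVED): `0 < ϑm`, `24 ≤ ra`, `ColdSereneDocket ϑm ra`, `TameBallTiltStrainBPG tameRadius 8` ⇒ [BHSᵇ]** — at ANY
positive moat temperature and ANY serenity radius `≥ 24`. [this file, g65] -/
theorem bareHotSparseBPG_of_cold_tameBallTiltStrain {ϑm ra : ℝ} (hm : 0 < ϑm) (hra : 24 ≤ ra) (hD : ColdSereneDocket ϑm ra)
    (hMK : TameBallTiltStrainBPG tameRadius 8 1 2 (1 / 16) (1 / 50)) :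
    BareHotSparseBPG tameRadius dressLevel dressLevel dressExponent 8 collarRadius clusterSize 1 2 (1 / 16) (1 / 50) :=
  bareHotSparseBPG_of_sereneMoatDocket le_rfl hra (sereneMoatDocket_of_cold_tameBallTiltStrain hm one_pos hD hMK)

/-- **RECORD ⇒ PACKAGE (PROVED)**: the four serene-cut binders of `_16XH24B` witness the existential serene moat docket at `(1/100, 24, 1/100, 1/200)` with the column's side
conditions `ϑ₁ ≤ ϑm`, `24 ≤ ra`, `4ω₁ + ϑ₁ < tameRadius` — the package binder of `_16XH27B` is WEAKER than (implied by) the four binders it replaces. [this file, g65] -/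
theorem sereneMoatDocket_of_record (hCMC : CoolMoatCorePG (1 / 100) tameRadius 8 4 12 1 2 (1 / 16) (1 / 50))
    (hSSH : SlenderSereneHotSparseBPG (1 / 100) tameRadius 8 24 dressLevel dressLevel dressExponent 8 collarRadius clusterSize 4 32 8 1 2 (1 / 16) (1 / 50))
    (hBSH : BuriedSereneHotSparseBPG (1 / 100) tameRadius 8 24 dressLevel dressLevel dressExponent 8 collarRadius clusterSize 8 1 2 (1 / 16) (1 / 50))
    (hTBIS : TameBallIncoherenceSparseBPG (1 / 100) (1 / 200) tameRadius 8 1 2 (1 / 16) (1 / 50)) :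
    ∃ ϑm ra ϑ₁ ω₁ : ℝ, ϑ₁ ≤ ϑm ∧ 24 ≤ ra ∧ 4 * ω₁ + ϑ₁ < tameRadius ∧ SereneMoatDocket ϑm ra ϑ₁ ω₁ :=
  ⟨1 / 100, 24, 1 / 100, 1 / 200, le_rfl, le_rfl, by norm_num [tameRadius], hCMC, hSSH, hBSH, hTBIS⟩

/-- **RECORD ⇒ EVERY COLDER, WIDER COLD–WIDE DOCKET (PROVED)**: the three `ϑc`-binders of `_16XH24B` give `ColdSereneDocket ϑm ra` for all `ϑm ≤ 1/100`, `ra ≥ 24`. -/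
theorem coldSereneDocket_of_record {ϑm ra : ℝ} (hle : ϑm ≤ 1 / 100) (hra : 24 ≤ ra) (hCMC : CoolMoatCorePG (1 / 100) tameRadius 8 4 12 1 2 (1 / 16) (1 / 50))
    (hSSH : SlenderSereneHotSparseBPG (1 / 100) tameRadius 8 24 dressLevel dressLevel dressExponent 8 collarRadius clusterSize 4 32 8 1 2 (1 / 16) (1 / 50))
    (hBSH : BuriedSereneHotSparseBPG (1 / 100) tameRadius 8 24 dressLevel dressLevel dressExponent 8 collarRadius clusterSize 8 1 2 (1 / 16) (1 / 50)) :
    ColdSereneDocket ϑm ra :=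
  ColdSereneDocket.of_le hle hra ⟨hCMC, hSSH, hBSH⟩

/-! ### YI-3  The columns: `_16XH27B` (∃-package over both dials, every binder implied by `_16XH24B`'s) and `_16XH27BT` (cold–wide docket at ANY positive temperature and
ANY radius `≥ 24` + (MKᵇᵃˡˡ)) -/

/-- ★★★ **COLUMN `_16XH27B`** — `_16XH24B` with its four serene-cut binders (hCMC, hSSH, hBSH, hTBIS at the record literals `ϑc = 1/100`, `ra = 24`) replaced by ONE existential
package `∃ ϑm ra ϑ₁ ω₁, ϑ₁ ≤ ϑm ∧ 24 ≤ ra ∧ 4ω₁ + ϑ₁ < tameRadius ∧ SereneMoatDocket ϑm ra ϑ₁ ω₁` (WEAKER: `sereneMoatDocket_of_record`, PROVED); [I_D], the 20 generic leaves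
and `PeriodicBulkGapDoor 2` unchanged ⇒ `VisibleGap (1/50) ∧ PertRegime (1/50)`.  The prover of the package CHOOSES the moat temperature and the serenity radius. [this file, g65] -/
theorem gap_and_pert_1_50_of_certs_16XH27B (hL : LatticeLiouvilleCert) (hL' : LayeredLiouvilleCert)
    (hR : OscRigidityL2BDPG 1 2 (1 / 16) (1 / 16)) (hX : ExcessFlatnessControlP 1 2 (1 / 16) (1 / 16))
    (hE : ExcessChartLocalisationP 1 2 (1 / 16) (1 / 100)) (hP : RegistrationP 1 2 (1 / 16) (1 / 100))
    (hT : TailDominationCert) (hU : UniformTameStabilityE (1 / 50) 2 (1 / 2000))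
    (h1 : WordTransplantP 1 2 (1 / 16) (1 / 100)) (hGT : GradReframingThickP 1 2 (1 / 16) (1 / 100) (1 / 50))
    (hΛ0 : LaunderingAprioriPX 1 2 (1 / 16) (1 / 100) (1 / 50)) (hΛs : LaunderingStepPX 1 2 (1 / 16) (1 / 100) (1 / 50))
    (hUc : UntwistCollarP 1 2 (1 / 16) (1 / 50))
    (hl : BondIsoLevelsP 1 2 (1 / 16) (1 / 50)) (hN : EnergyNearChartPX 1 2 (1 / 16) (1 / 50) (1 / 2000))
    (hF : TailForceSlavingP 1 2 (1 / 16) (1 / 50))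
    (hE' : LipDualLinearisationP 1 2 (1 / 16) (1 / 50)) (hA : L2HarmonicApproxPE 1 2 (1 / 16) (1 / 50) (1 / 2000))
    (hD : PositionDecayPLE 1 2 (1 / 16) (1 / 50) (1 / 2000)) (hC : PositionCaccioppoliPGE 1 2 (1 / 16) (1 / 50) (1 / 2000))
    (hI : DressedCorePG tameRadius dressLevel dressLevel dressExponent 8 collarRadius clusterSize 1 2 (1 / 16) (1 / 50))
    (hSMD : ∃ ϑm ra ϑ₁ ω₁ : ℝ, ϑ₁ ≤ ϑm ∧ 24 ≤ ra ∧ 4 * ω₁ + ϑ₁ < tameRadius ∧ SereneMoatDocket ϑm ra ϑ₁ ω₁)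
    (hG : PeriodicBulkGapDoor 2) : VisibleGap (1 / 50) ∧ PertRegime (1 / 50) := by
  obtain ⟨ϑm, ra, ϑ₁, ω₁, hϑ₁, hra, hside, hSD⟩ := hSMD
  exact gap_and_pert_1_50_of_certs_16XH18B_tol hL hL' hR hX hE hP hT hU h1 hGT hΛ0 hΛs hUc (untwistBookkeepingP_one 2 (1 / 50)) hl hN hF hE' hA hD hC
    (wildFractionBPG_of_dressedCore_serene_tameBallIncoherent hside (by norm_num) (by norm_num) (by linarith) hϑ₁ hI
      (sereneBareHotSparseBPG_of_coolMoat_slender_buried (by norm_num) (by norm_num) (by linarith) (by norm_num) hSD.1 hSD.2.1 hSD.2.2.1) hSD.2.2.2) hG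

/-- **`_16XH24B`'s binders ⇒ `_16XH27B`'s conclusion THROUGH the package (PROVED)** — the record column is an instance of the packaged one. [this file, g65] -/
theorem gap_and_pert_1_50_of_certs_16XH24B_via_27B (hL : LatticeLiouvilleCert) (hL' : LayeredLiouvilleCert)
    (hR : OscRigidityL2BDPG 1 2 (1 / 16) (1 / 16)) (hX : ExcessFlatnessControlP 1 2 (1 / 16) (1 / 16))
    (hE : ExcessChartLocalisationP 1 2 (1 / 16) (1 / 100)) (hP : RegistrationP 1 2 (1 / 16) (1 / 100))
    (hT : TailDominationCert) (hU : UniformTameStabilityE (1 / 50) 2 (1 / 2000))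
    (h1 : WordTransplantP 1 2 (1 / 16) (1 / 100)) (hGT : GradReframingThickP 1 2 (1 / 16) (1 / 100) (1 / 50))
    (hΛ0 : LaunderingAprioriPX 1 2 (1 / 16) (1 / 100) (1 / 50)) (hΛs : LaunderingStepPX 1 2 (1 / 16) (1 / 100) (1 / 50))
    (hUc : UntwistCollarP 1 2 (1 / 16) (1 / 50))
    (hl : BondIsoLevelsP 1 2 (1 / 16) (1 / 50)) (hN : EnergyNearChartPX 1 2 (1 / 16) (1 / 50) (1 / 2000))
    (hF : TailForceSlavingP 1 2 (1 / 16) (1 / 50))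
    (hE' : LipDualLinearisationP 1 2 (1 / 16) (1 / 50)) (hA : L2HarmonicApproxPE 1 2 (1 / 16) (1 / 50) (1 / 2000))
    (hD : PositionDecayPLE 1 2 (1 / 16) (1 / 50) (1 / 2000)) (hC : PositionCaccioppoliPGE 1 2 (1 / 16) (1 / 50) (1 / 2000))
    (hI : DressedCorePG tameRadius dressLevel dressLevel dressExponent 8 collarRadius clusterSize 1 2 (1 / 16) (1 / 50))
    (hCMC : CoolMoatCorePG (1 / 100) tameRadius 8 4 12 1 2 (1 / 16) (1 / 50))
    (hSSH : SlenderSereneHotSparseBPG (1 / 100) tameRadius 8 24 dressLevel dressLevel dressExponent 8 collarRadius clusterSize 4 32 8 1 2 (1 / 16) (1 / 50))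
    (hBSH : BuriedSereneHotSparseBPG (1 / 100) tameRadius 8 24 dressLevel dressLevel dressExponent 8 collarRadius clusterSize 8 1 2 (1 / 16) (1 / 50))
    (hTBIS : TameBallIncoherenceSparseBPG (1 / 100) (1 / 200) tameRadius 8 1 2 (1 / 16) (1 / 50))
    (hG : PeriodicBulkGapDoor 2) : VisibleGap (1 / 50) ∧ PertRegime (1 / 50) :=
  gap_and_pert_1_50_of_certs_16XH27B hL hL' hR hX hE hP hT hU h1 hGT hΛ0 hΛs hUc hl hN hF hE' hA hD hC hI (sereneMoatDocket_of_record hCMC hSSH hBSH hTBIS) hG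

/-- ★★★ **COLUMN `_16XH27BT` — THE COLD COLUMN**: `_16XH27B` with the package supplied by ANY POSITIVE MOAT TEMPERATURE AND ANY SERENITY RADIUS `≥ 24`,
`∃ ϑm ra, 0 < ϑm ∧ 24 ≤ ra ∧ ColdSereneDocket ϑm ra`, and the level-free (MKᵇᵃˡˡ) leaf `TameBallTiltStrainBPG tameRadius 8 1 2 (1/16) (1/50)` (a side door STRONGER than
[TBISᵇ(8)](1/100, 1/200), part YE — hence a SIDE column, as parts YE/YG's `…_of_tameBallTiltStrain` variants); observers' level `ϑ₁ := min ϑm (1/100)`, `ω₁ := 1/200`.  Along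
`ϑm ↓ 0`, `ra ↑ ∞` EVERY dial-dependent binder of this column is monotonically WEAKER (`ColdSereneDocket.of_le`): the coldest, widest serene cut is the cheapest, and its price is
prepaid by (MKᵇᵃˡˡ). [this file, g65] -/
theorem gap_and_pert_1_50_of_certs_16XH27BT (hL : LatticeLiouvilleCert) (hL' : LayeredLiouvilleCert)
    (hR : OscRigidityL2BDPG 1 2 (1 / 16) (1 / 16)) (hX : ExcessFlatnessControlP 1 2 (1 / 16) (1 / 16))
    (hE : ExcessChartLocalisationP 1 2 (1 / 16) (1 / 100)) (hP : RegistrationP 1 2 (1 / 16) (1 / 100))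
    (hT : TailDominationCert) (hU : UniformTameStabilityE (1 / 50) 2 (1 / 2000))
    (h1 : WordTransplantP 1 2 (1 / 16) (1 / 100)) (hGT : GradReframingThickP 1 2 (1 / 16) (1 / 100) (1 / 50))
    (hΛ0 : LaunderingAprioriPX 1 2 (1 / 16) (1 / 100) (1 / 50)) (hΛs : LaunderingStepPX 1 2 (1 / 16) (1 / 100) (1 / 50))
    (hUc : UntwistCollarP 1 2 (1 / 16) (1 / 50))
    (hl : BondIsoLevelsP 1 2 (1 / 16) (1 / 50)) (hN : EnergyNearChartPX 1 2 (1 / 16) (1 / 50) (1 / 2000))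
    (hF : TailForceSlavingP 1 2 (1 / 16) (1 / 50))
    (hE' : LipDualLinearisationP 1 2 (1 / 16) (1 / 50)) (hA : L2HarmonicApproxPE 1 2 (1 / 16) (1 / 50) (1 / 2000))
    (hD : PositionDecayPLE 1 2 (1 / 16) (1 / 50) (1 / 2000)) (hC : PositionCaccioppoliPGE 1 2 (1 / 16) (1 / 50) (1 / 2000))
    (hI : DressedCorePG tameRadius dressLevel dressLevel dressExponent 8 collarRadius clusterSize 1 2 (1 / 16) (1 / 50))
    (hMK : TameBallTiltStrainBPG tameRadius 8 1 2 (1 / 16) (1 / 50)) (hCold : ∃ ϑm ra : ℝ, 0 < ϑm ∧ 24 ≤ ra ∧ ColdSereneDocket ϑm ra)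
    (hG : PeriodicBulkGapDoor 2) : VisibleGap (1 / 50) ∧ PertRegime (1 / 50) := by
  obtain ⟨ϑm, ra, hm, hra, hCD⟩ := hCold
  have h₁ : 0 < min ϑm (1 / 100) := lt_min hm (by norm_num)
  have hside : 4 * (1 / 200 : ℝ) + min ϑm (1 / 100) < tameRadius := by
    have h := min_le_right ϑm (1 / 100)
    have ht : tameRadius = 1 / 20 := rfl
    rw [ht]
    linarith
  exact gap_and_pert_1_50_of_certs_16XH27B hL hL' hR hX hE hP hT hU h1 hGT hΛ0 hΛs hUc hl hN hF hE' hA hD hC hI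
    ⟨ϑm, ra, min ϑm (1 / 100), 1 / 200, min_le_left _ _, hra, hside, sereneMoatDocket_of_cold_tameBallTiltStrain h₁ (by norm_num) hCD hMK⟩ hG

/-- **THE COLD COLUMN AT A NAMED SETTING (PROVED)**: for every `0 < ϑm` and `ra ≥ 24`, the binders of `_16XH27BT` with `ColdSereneDocket ϑm ra` in place of the existential. -/
theorem gap_and_pert_1_50_of_certs_16XH27BT_at {ϑm ra : ℝ} (hm : 0 < ϑm) (hra : 24 ≤ ra) (hL : LatticeLiouvilleCert) (hL' : LayeredLiouvilleCert)
    (hR : OscRigidityL2BDPG 1 2 (1 / 16) (1 / 16)) (hX : ExcessFlatnessControlP 1 2 (1 / 16) (1 / 16))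
    (hE : ExcessChartLocalisationP 1 2 (1 / 16) (1 / 100)) (hP : RegistrationP 1 2 (1 / 16) (1 / 100))
    (hT : TailDominationCert) (hU : UniformTameStabilityE (1 / 50) 2 (1 / 2000))
    (h1 : WordTransplantP 1 2 (1 / 16) (1 / 100)) (hGT : GradReframingThickP 1 2 (1 / 16) (1 / 100) (1 / 50))
    (hΛ0 : LaunderingAprioriPX 1 2 (1 / 16) (1 / 100) (1 / 50)) (hΛs : LaunderingStepPX 1 2 (1 / 16) (1 / 100) (1 / 50))
    (hUc : UntwistCollarP 1 2 (1 / 16) (1 / 50))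
    (hl : BondIsoLevelsP 1 2 (1 / 16) (1 / 50)) (hN : EnergyNearChartPX 1 2 (1 / 16) (1 / 50) (1 / 2000))
    (hF : TailForceSlavingP 1 2 (1 / 16) (1 / 50))
    (hE' : LipDualLinearisationP 1 2 (1 / 16) (1 / 50)) (hA : L2HarmonicApproxPE 1 2 (1 / 16) (1 / 50) (1 / 2000))
    (hD : PositionDecayPLE 1 2 (1 / 16) (1 / 50) (1 / 2000)) (hC : PositionCaccioppoliPGE 1 2 (1 / 16) (1 / 50) (1 / 2000))
    (hI : DressedCorePG tameRadius dressLevel dressLevel dressExponent 8 collarRadius clusterSize 1 2 (1 / 16) (1 / 50))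
    (hMK : TameBallTiltStrainBPG tameRadius 8 1 2 (1 / 16) (1 / 50)) (hCD : ColdSereneDocket ϑm ra)
    (hG : PeriodicBulkGapDoor 2) : VisibleGap (1 / 50) ∧ PertRegime (1 / 50) :=
  gap_and_pert_1_50_of_certs_16XH27BT hL hL' hR hX hE hP hT hU h1 hGT hΛ0 hΛs hUc hl hN hF hE' hA hD hC hI hMK ⟨ϑm, ra, hm, hra, hCD⟩ hG

end Summit.AtomisticToContinuum.Crystallization.Theorems.ChartedZeroExcessLayeredLatticeLiouville

end
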